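import Summits.ResolutionOfSingularities.ResolutionOfSingularities.Theorems.WeightedInvariantIota3RowADominanceTools
import Summits.ResolutionOfSingularities.ResolutionOfSingularities.Theorems.WeightedInvariantPClassInitialMonomial

/-!
# (F-3d) Row A dominance — STEPS: small-weight exponents, the `X₁`-coefficient of `y`, case (α), the
# numerics of case (β)  [OURS · L1 W4.3]

Kernel infrastructure for RE-ENTRY OBJECT #1 of chain w43 (door crux `stmt-ResolutionOfSingularities-19897`),
rung (F-3d) «ROW A» of res-D-brk-1's Frobenius-class argument (O70B-JCAN-PLAN §7), power-series model
`S = K⟦X₀, X₁, X₂⟧` with the weights `(q, r₂, r₁)`.  The steps of the proof of `RowA.rowA_core`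
(file `…Iota3RowADominance`):

* `eq_single_of_weight_lt` — exponents of weight `< r₂` are pure `X₀`-powers;
* `initialMonomial_of_weightedOrder_lt` — `W(v) < r₂ ⇒` the initial form of `v` is a single monomial
  `X₀^{m₀}`, `W(v) = q m₀`;
* `coeff_single_one_eq_zero_of_reach` — Frobenius: `W(y^p + Λv^d + X₀^M) ≥ N > p r₂ ⇒ coeff_{X₁} y = 0`;
* `coeff_single_pow_ne_zero` — case (α): `coeff_{X₀^{d m₀}} (v^d) ≠ 0` (auxiliary weights `(1, L, L)`);
* `lt_binomial_weight`, `pClassComponent_zero_pow_of_pure` — case (β) bookkeeping.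

[OURS · L1 W4.3] NOT a statement of the manuscript; AI-produced, gate-checked, weaker than expert review.
-/

set_option linter.dupNamespace false

namespace Summit.ResolutionOfSingularities.ResolutionOfSingularities.Theorems.LocalEngine.Iota3.RowA

open MvPowerSeries IsLocalRing
open Summit.ResolutionOfSingularities.ResolutionOfSingularities.Theorems.LocalEngine.Iota3.PClass
open Summit.ResolutionOfSingularities.ResolutionOfSingularities.Cruxes.HypersurfaceCentreConstruction.LocalEngine.Iota3

variable {K : Type*} [Field K]

/-! ## Exponents of small weight -/

/-- An exponent of `(q, r₂, r₁)`-weight `< r₂ ≤ r₁` is a pure `X₀`-power. -/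
theorem eq_single_of_weight_lt {q r₁ r₂ : ℕ} (hr : r₂ ≤ r₁) {e : Fin 3 →₀ ℕ}
    (he : Finsupp.weight ![q, r₂, r₁] e < r₂) : e = Finsupp.single 0 (e 0) := by
  rw [weight_vec] at he
  have h1 : e 1 = 0 := by
    by_contra h
    have h1 : 1 ≤ e 1 := Nat.one_le_iff_ne_zero.mpr h
    nlinarith
  have h2 : e 2 = 0 := by
    by_contra h
    have h2 : 1 ≤ e 2 := Nat.one_le_iff_ne_zero.mpr h
    nlinarith
  ext i
  fin_cases i
  · simp
  · simpa using h1
  · simpa using h2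

/-- The weight of `X₀^k` is `q k`. -/
theorem weight_single_zero (q r₁ r₂ k : ℕ) : Finsupp.weight ![q, r₂, r₁] (Finsupp.single 0 k) = q * k := by
  rw [weight_vec]
  simp

/-- The weight of `X₁` is `r₂`. -/
theorem weight_single_one (q r₁ r₂ : ℕ) : Finsupp.weight ![q, r₂, r₁] (Finsupp.single 1 1) = r₂ := by
  rw [weight_vec]
  simp

/-- If `W(v) < r₂` then the initial form of `v` is a single monomial `X₀^{m₀}` with `W(v) = q m₀`. -/
theorem initialMonomial_of_weightedOrder_lt {q r₁ r₂ : ℕ} (hq : 0 < q) (hr : r₂ ≤ r₁)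
    {v : MvPowerSeries (Fin 3) K} (hv : v.weightedOrder ![q, r₂, r₁] < r₂) :
    ∃ m₀ : ℕ, coeff (Finsupp.single 0 m₀) v ≠ 0 ∧
      v.weightedOrder ![q, r₂, r₁] = ((q * m₀ : ℕ) : ℕ∞) ∧ q * m₀ < r₂ ∧
      ∀ d, coeff d v ≠ 0 → d ≠ Finsupp.single 0 m₀ →
        Finsupp.weight ![q, r₂, r₁] (Finsupp.single 0 m₀) < Finsupp.weight ![q, r₂, r₁] d := by
  have hfin : ((v.weightedOrder ![q, r₂, r₁]).toNat : ℕ∞) = v.weightedOrder ![q, r₂, r₁] :=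
    ENat.coe_toNat (ne_top_of_lt hv)
  obtain ⟨m, hcm, hwm⟩ := exists_coeff_ne_zero_and_weightedOrder _ hfin
  have hwlt : Finsupp.weight ![q, r₂, r₁] m < r₂ := by
    rw [← hwm] at hv
    exact_mod_cast hv
  have hm := eq_single_of_weight_lt hr hwlt
  have hwm0 : Finsupp.weight ![q, r₂, r₁] m = q * m 0 := by
    conv_lhs => rw [hm]
    rw [weight_single_zero]
  refine ⟨m 0, hm ▸ hcm, by rw [← hwm, hwm0], by rw [← hwm0]; exact hwlt, fun d hd hne => ?_⟩
  have hle : v.weightedOrder ![q, r₂, r₁] ≤ Finsupp.weight ![q, r₂, r₁] d := weightedOrder_le _ hd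
  rw [← hwm, Nat.cast_le] at hle
  rw [← hm]
  rcases hle.lt_or_eq with hlt | heq
  · exact hlt
  · exfalso
    have hd' := eq_single_of_weight_lt hr (heq ▸ hwlt)
    rw [hd', weight_single_zero, hwm0] at heq
    have h0 : m 0 = d 0 := Nat.eq_of_mul_eq_mul_left hq heq
    exact hne (by rw [hd', ← h0, ← hm])

/-! ## The `X₁`-coefficient of `y` -/

/-- From `W(y^p + Λ v^d + X₀^M) ≥ N > p r₂` (with `v(0) = 0`, `d > p`): `y` has no `X₁`-term. -/
theorem coeff_single_one_eq_zero_of_reach (p : ℕ) [Fact p.Prime] [CharP K p] {d M q r₁ r₂ N : ℕ}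
    (hlt : p < d) (hN : p * r₂ < N) {Λ : K} {y v : MvPowerSeries (Fin 3) K}
    (hv0 : constantCoeff v = 0)
    (hreach : (N : ℕ∞) ≤ (y ^ p + C Λ * v ^ d + X 0 ^ M).weightedOrder ![q, r₂, r₁]) :
    coeff (Finsupp.single 1 1) y = 0 := by
  classical
  have hw : Finsupp.weight ![q, r₂, r₁] (p • Finsupp.single (1 : Fin 3) 1) = p * r₂ := by
    rw [Finsupp.smul_single, smul_eq_mul, mul_one, weight_vec]; simp [mul_comm]
  have hz : coeff (p • Finsupp.single (1 : Fin 3) 1) (y ^ p + C Λ * v ^ d + X 0 ^ M) = 0 :=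
    coeff_eq_zero_of_lt_weightedOrder _ (lt_of_lt_of_le (by rw [hw]; exact_mod_cast hN) hreach)
  rw [map_add, map_add, coeff_nsmul_pow_expChar, coeff_C_mul,
    coeff_pow_eq_zero_of_degree_lt hv0 (by rw [degree_nsmul_single]; exact hlt), mul_zero, add_zero,
    coeff_X_pow, if_neg, add_zero] at hz
  · exact pow_eq_zero_iff (Nat.Prime.ne_zero Fact.out) |>.mp hz
  · rw [Finsupp.smul_single, smul_eq_mul, mul_one]
    intro h
    exact absurd ((Finsupp.single_eq_single_iff _ _ _ _).mp h) (by
      rintro (⟨h01, -⟩ | ⟨hp0, -⟩)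
      · exact absurd h01 (by decide)
      · exact (Nat.Prime.ne_zero Fact.out) hp0)

/-! ## Case (α): the `X₀^{d m₀}`-coefficient of `v^d` -/

/-- If the initial form of `v` is the single monomial `μ X₀^{m₀}` (for the weights `(q, r₂, r₁)`),
then `coeff X₀^{d m₀} (v^d) ≠ 0` for `d ≥ 1` (it is `μ^d`). -/
theorem coeff_single_pow_ne_zero {q r₁ r₂ : ℕ} {v : MvPowerSeries (Fin 3) K} {m₀ : ℕ}
    (hcm : coeff (Finsupp.single 0 m₀) v ≠ 0)
    (hini : ∀ d, coeff d v ≠ 0 → d ≠ Finsupp.single 0 m₀ →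
      Finsupp.weight ![q, r₂, r₁] (Finsupp.single 0 m₀) < Finsupp.weight ![q, r₂, r₁] d)
    {d : ℕ} (hd : 0 < d) : coeff (Finsupp.single 0 (d * m₀)) (v ^ d) ≠ 0 := by
  -- auxiliary weights `(1, L, L)`, `L = d m₀ + 1`: the initial form of `v` is still `X₀^{m₀}`
  set L := d * m₀ + 1 with hL
  have hwL : ∀ e : Fin 3 →₀ ℕ, Finsupp.weight ![1, L, L] e = e 0 + L * e 1 + L * e 2 := fun e => by
    rw [weight_fin_three]; simp [one_mul]
  have hm₀L : m₀ < L := by nlinarith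
  have hini' : ∀ e, coeff e v ≠ 0 → e ≠ Finsupp.single 0 m₀ →
      Finsupp.weight ![1, L, L] (Finsupp.single 0 m₀) < Finsupp.weight ![1, L, L] e := by
    intro e he hne
    rw [hwL, hwL]
    simp only [Finsupp.single_eq_same, Finsupp.single_eq_of_ne (show (1 : Fin 3) ≠ 0 by decide),
      Finsupp.single_eq_of_ne (show (2 : Fin 3) ≠ 0 by decide), mul_zero, add_zero]
    by_cases h12 : e 1 = 0 ∧ e 2 = 0
    · -- a pure `X₀`-power: compare with the `(q, r₂, r₁)`-weights
      have he' : e = Finsupp.single 0 (e 0) := by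
        ext i; fin_cases i
        · simp
        · simpa using h12.1
        · simpa using h12.2
      have h := hini e he hne
      rw [he', weight_single_zero, weight_single_zero] at h
      rw [h12.1, h12.2, mul_zero, add_zero, add_zero]
      exact Nat.lt_of_mul_lt_mul_left h
    · rw [not_and_or] at h12
      rcases h12 with h1 | h2
      · have : 1 ≤ e 1 := Nat.one_le_iff_ne_zero.mpr h1
        nlinarith
      · have : 1 ≤ e 2 := Nat.one_le_iff_ne_zero.mpr h2
        nlinarith
  have hWv : v.weightedOrder ![1, L, L] = (m₀ : ℕ) := by
    rw [weightedOrder_eq_of_initialMonomial _ hcm hini', hwL]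
    simp [Finsupp.single_eq_of_ne (show (1 : Fin 3) ≠ 0 by decide),
      Finsupp.single_eq_of_ne (show (2 : Fin 3) ≠ 0 by decide)]
  have hWvd : (v ^ d).weightedOrder ![1, L, L] = ((d * m₀ : ℕ) : ℕ∞) := by
    rw [weightedOrder_pow, hWv, nsmul_eq_mul, Nat.cast_mul]
  have hfin : (((v ^ d).weightedOrder ![1, L, L]).toNat : ℕ∞) = (v ^ d).weightedOrder ![1, L, L] := by
    rw [hWvd]; rfl
  obtain ⟨e, hce, hwe⟩ := exists_coeff_ne_zero_and_weightedOrder _ hfin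
  rw [hWvd, Nat.cast_inj, hwL] at hwe
  -- `e` weighs `d m₀ < L`: it is the pure power `X₀^{d m₀}`
  have h1 : e 1 = 0 := by
    by_contra h; have : 1 ≤ e 1 := Nat.one_le_iff_ne_zero.mpr h; nlinarith
  have h2 : e 2 = 0 := by
    by_contra h; have : 1 ≤ e 2 := Nat.one_le_iff_ne_zero.mpr h; nlinarith
  have he : e = Finsupp.single 0 (d * m₀) := by
    rw [h1, h2, mul_zero, add_zero, add_zero] at hwe
    ext i; fin_cases i
    · simpa using hwe
    · simpa using h1
    · simpa using h2
  rwa [he] at hce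

/-! ## Case (β): orders in the binomial expansion -/

/-- The numerical heart of case (β): for `2 ≤ k ≤ d` and `a < ρ`, `ρ + (d−1)a < kρ + (d−k)a`. -/
theorem lt_binomial_weight {a ρ d k : ℕ} (hk : 2 ≤ k) (hkd : k ≤ d) (h : a < ρ) :
    ρ + (d - 1) * a < k * ρ + (d - k) * a := by
  obtain ⟨j, rfl⟩ := Nat.exists_eq_add_of_le hkd
  obtain ⟨i, rfl⟩ := Nat.exists_eq_add_of_le hk
  rw [Nat.add_sub_cancel_left, show 2 + i + j - 1 = 1 + i + j by omega]
  nlinarith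

/-- Pure class-`0` elements are closed under powers. -/
theorem pClassComponent_zero_pow_of_pure (p : ℕ) [NeZero p] {G : MvPowerSeries (Fin 3) K}
    (hG : pClassComponent p 0 G = G) (j : ℕ) : pClassComponent p 0 (G ^ j) = G ^ j := by
  induction j with
  | zero =>
    rw [pow_zero]
    refine pClassComponent_eq_self fun e he => ?_
    rw [coeff_one] at he
    split_ifs at he with h
    · rw [h, exponentClass_zero]
    · exact absurd rfl he
  | succ j ih => rw [pow_succ, pClassComponent_mul_of_left_pure_zero ih, hG]

end Summit.ResolutionOfSingularities.ResolutionOfSingularities.Theorems.LocalEngine.Iota3.RowA
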